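import Literature.NumberTheory.LFunctions.SchoenfeldPsiSmall
import Literature.NumberTheory.LFunctions.ChebyshevSylvesterPsi
import Mathlib.NumberTheory.Chebyshev
import Mathlib.NumberTheory.ArithmeticFunction.Misc
import Mathlib.Analysis.SpecialFunctions.Stirling

/-!
# Stub `stub_helsonG` of line `Sketch` for crux `WeilComb.CombShapePositivity` — generating-function proof
(item stmt-RiemannHypothesis-11229, route route-RiemannHypothesis-WeilComb; siege attempt k = 8,
variation "generating-function manipulation")

The Helson potential with the sharpened prime-power constant: for every `M` and `a : ℕ → ℂ`,

`Σ_{m ≤ M} ‖a_m‖² (log m + ψ₁(M/m)) ≤ (log M + 39/50) Σ_{m ≤ M} ‖a_m‖²`, `ψ₁(y) = Σ_{n ≤ y} Λ(n)/n`.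

Proof (Chebyshev–Mertens, through the Dirichlet-series identity `(−ζ'/ζ)·ζ = −ζ'`, i.e. `Λ * ζ = log`
as arithmetic functions). Termwise it suffices that `ψ₁(N) ≤ log N + 39/50` for every natural `N ≥ 1`
(then `log m + ψ₁(⌊M/m⌋) ≤ log m + log⌊M/m⌋ + 39/50 ≤ log M + 39/50`). Summing `Λ * ζ = log` over
`n ≤ N` (Mathlib's `ArithmeticFunction.sum_Ioc_mul_zeta_eq_sum`, `vonMangoldt_mul_zeta`) gives
Chebyshev's identity `Σ_{n ≤ N} Λ(n) ⌊N/n⌋ = log N!`; since `N + 1 ≤ n ⌊N/n⌋ + n`,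

`(N + 1) ψ₁(N) ≤ Σ_{n ≤ N} Λ(n) (⌊N/n⌋ + 1) = log N! + ψ(N)`.

Now `log N! ≤ N log N − N + ½ log N + 1` (monotonicity of the Stirling sequence,
`Stirling.log_stirlingSeq'_antitone`, `stirlingSeq 1 = e/√2`) and `ψ(N) ≤ (23/20) N`
(the tree's explicit Chebyshev bounds: `SchoenfeldBound.psi_le_of_le_ten_thousand`, `ψ ≤ 1.04 x` on
`[0, 10⁴]`, and `psi_le_sylvester`, `ψ(x) ≤ 1.0722 x + 7 √x`, beyond), so
`(N + 1) ψ₁(N) ≤ (N + 1)(log N + 39/50) − (½ log N + (63/100) N − 11/50) ≤ (N + 1)(log N + 39/50)`.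

No Rosser–Schoenfeld table (3.24) and no prime-by-prime numerics are used; the constant that this
argument actually yields is `ψ(N)/N − 1 + O(log N / N) ≤ 3/20 + o(1)`, far inside `39/50`.
-/

noncomputable section

-- the sub-problem path RiemannHypothesis/RiemannHypothesis duplicates a namespace (D-0017)
set_option linter.dupNamespace false

open scoped BigOperators

namespace Summit.RiemannHypothesis.RiemannHypothesis.Theorems.WeilCombBohrFejer.VonMangoldtZeta

open Literature.NumberTheory.LFunctions

/-- `Σ_{1 ≤ n ≤ N} log n = log N!`. [folklore] -/
theorem sum_Ioc_log_eq_log_factorial (N : ℕ) :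
    ∑ n ∈ Finset.Ioc 0 N, Real.log (n : ℝ) = Real.log (N.factorial : ℝ) := by
  induction N with
  | zero => simp
  | succ k ih =>
    rw [Finset.sum_Ioc_succ_top (Nat.zero_le k), ih, Nat.factorial_succ, Nat.cast_mul,
      Real.log_mul (by positivity) (by positivity), add_comm]

/-- **Chebyshev's identity** `Σ_{1 ≤ n ≤ N} Λ(n) ⌊N/n⌋ = log N!`, the coefficientwise form of
`(Λ * ζ)(n) = log n` summed over `n ≤ N`. [folklore] -/
theorem sum_Ioc_vonMangoldt_mul_div (N : ℕ) :
    ∑ n ∈ Finset.Ioc 0 N, (ArithmeticFunction.vonMangoldt n : ℝ) * ((N / n : ℕ) : ℝ) =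
      Real.log (N.factorial : ℝ) := by
  have h := ArithmeticFunction.sum_Ioc_mul_zeta_eq_sum ArithmeticFunction.vonMangoldt N
  rw [ArithmeticFunction.vonMangoldt_mul_zeta] at h
  rw [← h, ← sum_Ioc_log_eq_log_factorial N]
  simp only [ArithmeticFunction.log_apply]

/-- **Stirling upper bound** `log N! ≤ N log N − N + ½ log N + 1` for `N ≥ 1`, from the monotonicity of
the Stirling sequence `N!/(√(2N) (N/e)^N) ≤ 1!/(√2/e) = e/√2`. [folklore] -/
theorem log_factorial_le {N : ℕ} (hN : N ≠ 0) :
    Real.log (N.factorial : ℝ) ≤ N * Real.log N - N + Real.log N / 2 + 1 := by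
  obtain ⟨k, rfl⟩ := Nat.exists_eq_succ_of_ne_zero hN
  have h := Stirling.log_stirlingSeq'_antitone (Nat.zero_le k)
  simp only [Function.comp_apply, Nat.succ_eq_add_one, zero_add, Stirling.stirlingSeq_one] at h
  rw [Stirling.log_stirlingSeq_formula, Real.log_div (Real.exp_pos 1).ne' (by positivity),
    Real.log_exp, Real.log_sqrt zero_le_two, Real.log_mul two_ne_zero (by positivity),
    Real.log_div (by positivity) (Real.exp_pos 1).ne', Real.log_exp] at h
  push_cast at h ⊢
  nlinarith [h, Real.log_nonneg (show (1 : ℝ) ≤ (k : ℝ) + 1 by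
    have : (0 : ℝ) ≤ k := Nat.cast_nonneg k
    linarith)]

-- adapted from Theorems/WeilCombCombShapePositivityStubPoincareEta.lean (`sum_Icc_vonMangoldt_le_poincareEta`)
/-- The tree's explicit Chebyshev bound at natural arguments: `ψ(K) ≤ (23/20) K` — for `K ≤ 10⁴` from
`ψ(x) ≤ 1.04 x` (`SchoenfeldBound.psi_le_of_le_ten_thousand`), for `K ≥ 10⁴` from
`ψ(x) ≤ 1.0722 x + 7 √x` (`psi_le_sylvester`) and `7 √K ≤ 0.07 K`. [folklore] -/
theorem psi_natCast_le (K : ℕ) : Chebyshev.psi (K : ℝ) ≤ 23 / 20 * (K : ℝ) := by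
  have hK0 : (0 : ℝ) ≤ K := Nat.cast_nonneg K
  rcases le_or_gt (K : ℝ) 10000 with hK | hK
  · have h := SchoenfeldBound.psi_le_of_le_ten_thousand hK0 hK
    linarith
  · have h := psi_le_sylvester hK0
    have h100 : (100 : ℝ) ≤ Real.sqrt K := by
      rw [Real.le_sqrt (by norm_num) hK0]
      nlinarith
    have hss : Real.sqrt K * Real.sqrt K = K := Real.mul_self_sqrt hK0
    nlinarith [Real.sqrt_nonneg (K : ℝ), mul_nonneg (Real.sqrt_nonneg (K : ℝ)) (sub_nonneg.2 h100)]

/-- **Mertens-type bound with an explicit constant**: `Σ_{1 ≤ n ≤ N} Λ(n)/n ≤ log N + 39/50` for every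
natural `N` (for `N = 0` both sides are read with `log 0 = 0`). From `(N+1) Σ_{n ≤ N} Λ(n)/n ≤ log N! + ψ(N)`
(Chebyshev's identity and `N + 1 ≤ n⌊N/n⌋ + n`), Stirling's upper bound and `ψ(N) ≤ (23/20) N`. [folklore] -/
theorem sum_Icc_vonMangoldt_div_le (N : ℕ) :
    ∑ n ∈ Finset.Icc 1 N, (ArithmeticFunction.vonMangoldt n : ℝ) / n ≤ Real.log N + 39 / 50 := by
  rcases Nat.eq_zero_or_pos N with rfl | hN
  · norm_num
  have e : Finset.Icc 1 N = Finset.Ioc 0 N := by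
    ext n
    simp only [Finset.mem_Icc, Finset.mem_Ioc]
    omega
  rw [e]
  have hkey : ((N : ℝ) + 1) * ∑ n ∈ Finset.Ioc 0 N, (ArithmeticFunction.vonMangoldt n : ℝ) / n ≤
      Real.log (N.factorial : ℝ) + ∑ n ∈ Finset.Ioc 0 N, (ArithmeticFunction.vonMangoldt n : ℝ) := by
    rw [← sum_Ioc_vonMangoldt_mul_div N, Finset.mul_sum, ← Finset.sum_add_distrib]
    refine Finset.sum_le_sum fun n hn => ?_
    have hn0 : 0 < n := (Finset.mem_Ioc.1 hn).1
    have hΛ : 0 ≤ (ArithmeticFunction.vonMangoldt n : ℝ) := ArithmeticFunction.vonMangoldt_nonneg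
    have hn' : (0 : ℝ) < n := by exact_mod_cast hn0
    have hdiv : (N : ℝ) + 1 ≤ (n : ℝ) * ((N / n : ℕ) : ℝ) + n := by
      have h1 : N + 1 ≤ n * (N / n) + n := Nat.succ_le_of_lt (Nat.lt_mul_div_succ N hn0)
      exact_mod_cast h1
    calc ((N : ℝ) + 1) * ((ArithmeticFunction.vonMangoldt n : ℝ) / n)
        = (ArithmeticFunction.vonMangoldt n : ℝ) * (((N : ℝ) + 1) / n) := by ring
      _ ≤ (ArithmeticFunction.vonMangoldt n : ℝ) * (((N / n : ℕ) : ℝ) + 1) := by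
          refine mul_le_mul_of_nonneg_left ?_ hΛ
          rw [div_le_iff₀ hn']
          linarith
      _ = (ArithmeticFunction.vonMangoldt n : ℝ) * ((N / n : ℕ) : ℝ) +
            (ArithmeticFunction.vonMangoldt n : ℝ) := by ring
  have hψ : ∑ n ∈ Finset.Ioc 0 N, (ArithmeticFunction.vonMangoldt n : ℝ) ≤ 23 / 20 * (N : ℝ) := by
    have := psi_natCast_le N
    rwa [Chebyshev.psi, Nat.floor_natCast] at this
  have hfact := log_factorial_le hN.ne'
  have hlog : 0 ≤ Real.log N := Real.log_natCast_nonneg N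
  have hN1 : (1 : ℝ) ≤ N := by exact_mod_cast hN
  have hpos : (0 : ℝ) < N + 1 := by positivity
  refine le_of_mul_le_mul_left ?_ hpos
  linarith

/-- **Stub S4 — Helson potential with the sharpened prime-power constant** (line `Sketch`, crux
`WeilComb.CombShapePositivity`). For every `M`, `a`:
`Σ_m ‖a_m‖² (log m + ψ₁(M/m)) ≤ (log M + 39/50) Σ ‖a_m‖²`, `ψ₁(y) = Σ_{n ≤ y} Λ(n)/n` — termwise
`log m + ψ₁(⌊M/m⌋) ≤ log m + log⌊M/m⌋ + 39/50 ≤ log M + 39/50` by `sum_Icc_vonMangoldt_div_le`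
(Chebyshev's identity `Σ Λ(n)⌊N/n⌋ = log N!`, Stirling, `ψ ≤ (23/20) x`). [folklore] -/
theorem stub_helsonG : ∀ (M : ℕ) (a : ℕ → ℂ),
    ∑ m ∈ Finset.Icc 1 M, ‖a m‖ ^ 2 *
        (Real.log m + ∑ n ∈ Finset.Icc 1 (M / m), (ArithmeticFunction.vonMangoldt n : ℝ) / n) ≤
      (Real.log M + 39 / 50) * ∑ m ∈ Finset.Icc 1 M, ‖a m‖ ^ 2 := by
  intro M a
  rw [Finset.mul_sum]
  refine Finset.sum_le_sum fun m hm => ?_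
  rw [mul_comm (Real.log M + 39 / 50)]
  refine mul_le_mul_of_nonneg_left ?_ (by positivity)
  have hm1 : 1 ≤ m := (Finset.mem_Icc.1 hm).1
  have hmM : m ≤ M := (Finset.mem_Icc.1 hm).2
  have h := sum_Icc_vonMangoldt_div_le (M / m)
  have hq1 : 1 ≤ M / m := (Nat.le_div_iff_mul_le hm1).2 (by simpa using hmM)
  have hm0 : (0 : ℝ) < m := by exact_mod_cast hm1
  have hq0 : (0 : ℝ) < ((M / m : ℕ) : ℝ) := by exact_mod_cast hq1
  have hle : ((M / m : ℕ) : ℝ) * m ≤ M := by exact_mod_cast Nat.div_mul_le_self M m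
  have hlogle : Real.log ((M / m : ℕ) : ℝ) + Real.log m ≤ Real.log M := by
    rw [← Real.log_mul hq0.ne' hm0.ne']
    exact Real.log_le_log (by positivity) hle
  linarith

end Summit.RiemannHypothesis.RiemannHypothesis.Theorems.WeilCombBohrFejer.VonMangoldtZeta

end
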